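import Summits.Ventures.LatticeQCDFlow.Scoring.SUNOnePlaquettePlaquetteBessel
import Literature.Analysis.FunctionSpaces.BesselIAdditionTheorem
import Literature.Analysis.FunctionSpaces.BesselIRecurrence
import Literature.Analysis.FunctionSpaces.BesselIIntegralSeries
import HarnessLib

/-!
# The `SU(N)` plaquette formula at `N = 2` IS GEN-7/9's `I₂(2β)/I₁(2β)`: an end-to-end cross-check

HONEST FRAMING: exact (Metropolis-corrected) sampling algorithms for lattice gauge theory;
figures of merit are autocorrelation/cost numbers at stated couplings and volumes; no
continuum-physics claim.

Venture `LatticeQCDFlow` (cell pub-lqcd), sub-topic `Scoring`; FANOUT row 5 (`s0-sun-a`), GEN-17.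
NEW WORK of the cell (placement rule).  `SUNOnePlaquettePlaquetteBessel` expresses theory-2's `SU(N)` one-plaquette
plaquette for EVERY `N` as `Σ_q Σ_l (det D⁻_{q,l}(β) + det D⁺_{q,l}(β)) / (2N Σ_q det[I_{|q+i−j|}(β)])` (Weyl's
integration formula ⟶ Bessel–Toeplitz series ⟶ mgf/cgf calculus ⟶ Jacobi's formula ⟶ term-wise
differentiation).  Here the `N = 2` case of that formula is evaluated in closed form with NEUMANN'S ADDITION THEOREM
(`Σ_k I_{|k+a|}(β) I_{|k+b|}(β) = I_{|b−a|}(2β)`, `Literature/…/BesselIAdditionTheorem`) and the recurrence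
`x(I_n − I_{n+2}) = 2(n+1) I_{n+1}`:

* `hasSum_besselI_shift_mul_shift` — `Σ_q I_{|q+a|}(x) I_{|q+b|}(x) = I_{|b−a|}(2x)`;
* `hasSum_su2_denominator` — `Σ_q det D_q(β) = I₀(2β) − I₂(2β)`; `hasSum_su2_numerator` —
  `Σ_q Σ_l (det D⁻_{q,l} + det D⁺_{q,l})(β) = 2(I₁(2β) − I₃(2β))`;
* **`specialUnitary_plaquette_two_eq_besselI_ratio`** — for `β > 0`, theory-2's `SU(2)` one-plaquette plaquette
  `∫ ½ Re tr U e^{−β(2 − Re tr U)} dU / ∫ e^{−β(2 − Re tr U)} dU` on the Haar measure of `SU(2)` equals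
  **`I₂(2β)/I₁(2β)`** — the value GEN-7 (`OnePlaquetteBessel`) and GEN-9 (`SU2HaarClassAngle`) obtained by entirely
  different means (class-angle density `(2/π) sin²α`): the general-`N` chain agrees with the `SU(2)` oracle.

No `def`, nothing cited as a fact, 0 sorry.
-/

noncomputable section

open Real MeasureTheory Filter Topology Finset Complex Set
open scoped ENNReal
open ProbabilityTheory
open Literature.MathematicalPhysics.QuantumFieldTheory
open Literature.MathematicalPhysics.QuantumLattice
open Literature.Analysis.FunctionSpaces

namespace Summit.Ventures.LatticeQCDFlow.Scoring

/-! ### 1. Shifted products of Bessel functions -/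

/-- **`Σ_{q∈ℤ} I_{|q+a|}(x) I_{|q+b|}(x) = I_{|b−a|}(2x)`** (Neumann's addition theorem, reindexed). -/
theorem hasSum_besselI_shift_mul_shift (x : ℝ) (a b : ℤ) :
    HasSum (fun q : ℤ => besselI (q + a).natAbs x * besselI (q + b).natAbs x) (besselI (b - a).natAbs (2 * x)) := by
  have h := hasSum_besselI_natAbs_mul_shift x (b - a)
  have h2 : HasSum ((fun k : ℤ => besselI k.natAbs x * besselI (b - a + k).natAbs x) ∘ (Equiv.addRight a))
      (besselI (b - a).natAbs (2 * x)) := (Equiv.addRight a).hasSum_iff.2 h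
  refine h2.congr_fun fun q => ?_
  simp only [Function.comp_apply, Equiv.coe_addRight]
  congr 3
  ring

/-! ### 2. The `N = 2` series in closed form -/

/-- The `2 × 2` determinant `det D_q(β) = I_{|q|}(β)² − I_{|q−1|}(β) I_{|q+1|}(β)`. -/
theorem det_besselI_shift_fin_two (q : ℤ) (β : ℝ) :
    (Matrix.of fun i j : Fin 2 => besselI (q + (i : ℤ) - (j : ℤ)).natAbs β).det
      = besselI (q + 0).natAbs β * besselI (q + 0).natAbs β - besselI (q + (-1)).natAbs β * besselI (q + 1).natAbs β := by
  rw [Matrix.det_fin_two]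
  simp only [Matrix.of_apply, Fin.val_zero, Fin.val_one, Nat.cast_zero, Nat.cast_one]
  ring_nf

/-- **`Σ_q det D_q(β) = I₀(2β) − I₂(2β)`.** -/
theorem hasSum_su2_denominator (β : ℝ) :
    HasSum (fun q : ℤ => (Matrix.of fun i j : Fin 2 => besselI (q + (i : ℤ) - (j : ℤ)).natAbs β).det)
      (besselI 0 (2 * β) - besselI 2 (2 * β)) := by
  simp_rw [det_besselI_shift_fin_two]
  have h := (hasSum_besselI_shift_mul_shift β 0 0).sub (hasSum_besselI_shift_mul_shift β (-1) 1)
  have hv : besselI ((0 : ℤ) - 0).natAbs (2 * β) - besselI ((1 : ℤ) - -1).natAbs (2 * β)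
      = besselI 0 (2 * β) - besselI 2 (2 * β) := by norm_num
  rw [hv] at h
  exact h

/-- The column-replaced `2 × 2` determinants, summed over the two columns and both shifts, for fixed `q`:
`(det D⁻_{q,0} + det D⁺_{q,0}) + (det D⁻_{q,1} + det D⁺_{q,1})`
`= (I_{|q+1|}I_{|q|} − I_{|q−1|}I_{|q+2|}) + (I_{|q|}I_{|q−1|} − I_{|q−2|}I_{|q+1|})` (the other two vanish). -/
theorem sum_det_updateCol_besselI_shift_fin_two (q : ℤ) (β : ℝ) :
    ∑ l : Fin 2,
        ((((Matrix.of fun i j : Fin 2 => besselI (q + (i : ℤ) - (j : ℤ)).natAbs β).updateCol l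
            fun i => besselI (q + (i : ℤ) - (l : ℤ) - 1).natAbs β).det
          + ((Matrix.of fun i j : Fin 2 => besselI (q + (i : ℤ) - (j : ℤ)).natAbs β).updateCol l
            fun i => besselI (q + (i : ℤ) - (l : ℤ) + 1).natAbs β).det))
      = (besselI (q + 1).natAbs β * besselI (q + 0).natAbs β - besselI (q + (-1)).natAbs β * besselI (q + 2).natAbs β)
        + (besselI (q + 0).natAbs β * besselI (q + (-1)).natAbs β
            - besselI (q + (-2)).natAbs β * besselI (q + 1).natAbs β) := by
  rw [Fin.sum_univ_two, Matrix.det_fin_two, Matrix.det_fin_two, Matrix.det_fin_two, Matrix.det_fin_two]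
  simp only [Matrix.updateCol_apply, Matrix.of_apply, Fin.val_zero, Fin.val_one, Nat.cast_zero, Nat.cast_one,
    if_true, Fin.zero_eq_one_iff, OfNat.ofNat_ne_one, one_ne_zero, if_false]
  ring_nf

/-- **`Σ_q Σ_l (det D⁻_{q,l} + det D⁺_{q,l})(β) = 2 (I₁(2β) − I₃(2β))`.** -/
theorem hasSum_su2_numerator (β : ℝ) :
    HasSum (fun q : ℤ => ∑ l : Fin 2,
        ((((Matrix.of fun i j : Fin 2 => besselI (q + (i : ℤ) - (j : ℤ)).natAbs β).updateCol l
            fun i => besselI (q + (i : ℤ) - (l : ℤ) - 1).natAbs β).det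
          + ((Matrix.of fun i j : Fin 2 => besselI (q + (i : ℤ) - (j : ℤ)).natAbs β).updateCol l
            fun i => besselI (q + (i : ℤ) - (l : ℤ) + 1).natAbs β).det)))
      (2 * (besselI 1 (2 * β) - besselI 3 (2 * β))) := by
  simp_rw [sum_det_updateCol_besselI_shift_fin_two]
  have h := ((hasSum_besselI_shift_mul_shift β 1 0).sub (hasSum_besselI_shift_mul_shift β (-1) 2)).add
    ((hasSum_besselI_shift_mul_shift β 0 (-1)).sub (hasSum_besselI_shift_mul_shift β (-2) 1))
  have hv : besselI ((0 : ℤ) - 1).natAbs (2 * β) - besselI ((2 : ℤ) - -1).natAbs (2 * β)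
      + (besselI ((-1 : ℤ) - 0).natAbs (2 * β) - besselI ((1 : ℤ) - -2).natAbs (2 * β))
      = 2 * (besselI 1 (2 * β) - besselI 3 (2 * β)) := by
    norm_num
    ring
  rw [hv] at h
  exact h

/-! ### 3. The cross-check -/

/-- **THE GENERAL-`N` `SU(N)` PLAQUETTE FORMULA AT `N = 2` IS `I₂(2β)/I₁(2β)`** (`β > 0`): the end-to-end agreement
of the Weyl/Bessel–Toeplitz/Jacobi chain with GEN-7/9's `SU(2)` one-plaquette law. -/
theorem specialUnitary_plaquette_two_eq_besselI_ratio {β : ℝ} (hβ : 0 < β) :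
    (∫ u, ((u : Matrix.specialUnitaryGroup (Fin 2) ℂ) : Matrix (Fin 2) (Fin 2) ℂ).trace.re / (2 : ℕ) *
          Real.exp (-(β * (((2 : ℕ) : ℝ) - ((u : Matrix.specialUnitaryGroup (Fin 2) ℂ) :
            Matrix (Fin 2) (Fin 2) ℂ).trace.re))) ∂(haarProbability (Matrix.specialUnitaryGroup (Fin 2) ℂ)))
      / (∫ u, Real.exp (-(β * (((2 : ℕ) : ℝ) - ((u : Matrix.specialUnitaryGroup (Fin 2) ℂ) :
          Matrix (Fin 2) (Fin 2) ℂ).trace.re))) ∂(haarProbability (Matrix.specialUnitaryGroup (Fin 2) ℂ)))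
      = besselI 2 (2 * β) / besselI 1 (2 * β) := by
  rw [specialUnitary_plaquette_eq_bessel 2 β, (hasSum_su2_numerator β).tsum_eq, (hasSum_su2_denominator β).tsum_eq]
  -- the recurrences at `z = 2β`: `z(I₀ − I₂) = 2 I₁`, `z(I₁ − I₃) = 4 I₂`
  have r0 := mul_besselI_sub_besselI_add_two 0 (2 * β)
  have r1 := mul_besselI_sub_besselI_add_two 1 (2 * β)
  norm_num at r0 r1
  have hz : (2 * β) ≠ 0 := by positivity
  have hI1 : 0 < besselI 1 (2 * β) :=
    (besselI_nonneg 2 (by positivity)).trans_lt (besselI_succ_lt 1 (by positivity))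
  have e0 : besselI 0 (2 * β) - besselI 2 (2 * β) = besselI 1 (2 * β) / β := by
    field_simp
    linarith
  have e1 : besselI 1 (2 * β) - besselI 3 (2 * β) = 2 * besselI 2 (2 * β) / β := by
    field_simp
    linarith
  rw [e0, e1]
  push_cast
  field_simp

end Summit.Ventures.LatticeQCDFlow.Scoring
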